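import Mathlib
import HarnessLib
import Literature.MathematicalPhysics.StatisticalMechanics.FluctuationKernelComparisonABKM
import Literature.MathematicalPhysics.StatisticalMechanics.StepOperatorBLipschitz

/-!
# The `ℓ = 1` integration property for a PAIR of step kernels (torus data), in the shape consumed
# by the renormalisation-step chain, and `‖B_{𝒞a}K − B_{𝒞b}K‖_{k+1,0}` from primitive hypotheses
# ([ABKM19] Lemma 8.4 (`ℓ = 1`), Lemma 12.6 (12.52))

The single-kernel chain of the renormalisation step (`…_of_stepKernelBounds` lemmas) consumes the
integration property (w7′)/Lemma 8.4 (`ℓ = 0`) at every call site in ONE shape: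
`TayNormLE (P.gauge k X) r₀ (w_{k:k+1}^X) (fluct 𝒞q F) (b · A𝒫'^{|X|_k})` from
`TayNormLE (P.gauge k X) r₀ (w_k^X) F b` on an arbitrary `k`-polymer `X`.  The Lipschitz dependence of
the step on the kernel (hypotheses `hb`, `hl` of Lemma 12.6) needs the same shape for the
DIFFERENCE of two kernels, with constant `b · ℓ · κ^{|X|_k}`:

* **`tayNormLE_fluct_sub_fluct_pow_abkm`** — from the thirteen primitive hypotheses on the pair
  (`StepKernelBounds` for `𝒞a`, `𝒞b`, `p·𝒞b`; evenness, zero sums, positive multipliers off the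
  zero mode; `|Re 𝒞̂a − Re 𝒞̂b| ≤ δ Re 𝒞̂a`, `δ ≤ 1/(16q)`):
  `TayNormLE (P.gauge k X) r₀ (w_{k:k+1}^X) (fluct 𝒞a F − fluct 𝒞b F) (b · ℓ · κ^{|X|_k})` with
  **`ℓ = (r₀+1) · gaussCompConst(|Λ|, q) · δ`** and **`κ = A𝒫p^{1/p}`** — the drop-in replacement of
  `StepKernelBounds.tayNormLE_fluct` for the difference twins of the chain;
* **`hamNorm_opB_sub_abkm_le`** — `‖B_{𝒞a} K − B_{𝒞b} K‖_{k+1,0} ≤ L^d C_{8.7} · C ℓ κ A^{−1}` for the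
  torus data from the same primitive hypotheses (`StepOperatorBLipschitz` ∘ the above): hypothesis
  (12.52) of Lemma 12.6 for `B_k` at the level of kernels.

Everything is proved; no named fact.

## References
* S. Adams, S. Buchholz, R. Kotecký, S. Müller, arXiv:1910.13564, Lemma 8.4, Lemma 12.6 (12.52)
  [AdamsBuchholzKoteckyMuller2019].
-/

noncomputable section

namespace Literature.MathematicalPhysics.StatisticalMechanics.GradientRG

open scoped BigOperators
open Finset MeasureTheory
open Literature.MathematicalPhysics.StatisticalMechanics.GradientFRD (fourierCoeff)
open Literature.MathematicalPhysics.StatisticalMechanics.TorusPolymer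
  (IsPolymer numBlocks blockOf boxCorner)
open Literature.Barriers.CriticalPhenomena.LongRangePhi4.Polymer (IsConn)
open Literature.MathematicalPhysics.QuantumFieldTheory

variable {d M : ℕ} [NeZero M]

/-- `(A^n)^{1/p} = (A^{1/p})^n` for `A ≥ 0` (bookkeeping of the constant).
[cite: AdamsBuchholzKoteckyMuller2019, Lemma 8.4] -/
theorem pow_rpow_inv_eq_rpow_inv_pow {A : ℝ} (hA : 0 ≤ A) (n : ℕ) (p : ℝ) :
    (A ^ n) ^ (1 / p) = (A ^ (1 / p)) ^ n := by
  rw [← Real.rpow_natCast A n, ← Real.rpow_mul hA, mul_comm, Real.rpow_mul hA, Real.rpow_natCast]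

/-- **The `ℓ = 1` integration property for a pair of step kernels, torus data, product form of the
constant**: under the hypotheses of `tayNormLE_fluct_sub_fluct_abkm` (and `A𝒫p ≥ 0`), for every
`k`-polymer `X` and every `T_k^{X*}`-local `C^{r₀}` functional `F` with `‖F‖_{k,X} ≤ b`:
`‖fluct 𝒞a F − fluct 𝒞b F‖_{k:k+1,X} ≤ b · ℓ · κ^{|X|_k}`, `ℓ = (r₀+1)·gaussCompConst(|Λ|,q)·δ`,
`κ = A𝒫p^{1/p}`. [cite: AdamsBuchholzKoteckyMuller2019, Lemma 8.4] -/
theorem tayNormLE_fluct_sub_fluct_pow_abkm {L N Mord R n pT r₀ : ℕ}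
    {θbar lam μ δ₁ δ₀ A𝒫 A𝒫a A𝒫b A𝒫p C₂a C₂b C₂p h A : ℝ} {𝒞 : ℕ → (Fin d → ZMod M) → ℝ}
    {𝒞a 𝒞b : (Fin d → ZMod M) → ℝ}
    (hB : AbkmWeightBounds L N Mord R n θbar lam μ δ₁ δ₀ A𝒫 𝒞
      (abkmWeightData L N Mord R θbar (schedDelta δ₀ δ₁ N) 𝒞))
    {k : ℕ}
    (hSa : StepKernelBounds (abkmWeightData L N Mord R θbar (schedDelta δ₀ δ₁ N) 𝒞) L k A𝒫a C₂a 𝒞a)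
    (hSb : StepKernelBounds (abkmWeightData L N Mord R θbar (schedDelta δ₀ δ₁ N) 𝒞) L k A𝒫b C₂b 𝒞b)
    {p q : ℝ} (hpq : p.HolderConjugate q)
    (hSp : StepKernelBounds (abkmWeightData L N Mord R θbar (schedDelta δ₀ δ₁ N) 𝒞) L k A𝒫p C₂p
      (fun x => p * 𝒞b x)) (hA𝒫p : 0 ≤ A𝒫p)
    (hea : ∀ x, 𝒞a (-x) = 𝒞a x) (heb : ∀ x, 𝒞b (-x) = 𝒞b x)
    (h0a : ∑ x, 𝒞a x = 0) (h0b : ∑ x, 𝒞b x = 0)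
    (hposa : ∀ κ, κ ≠ 0 → 0 < (fourierCoeff 𝒞a κ).re)
    (hposb : ∀ κ, κ ≠ 0 → 0 < (fourierCoeff 𝒞b κ).re)
    {δ : ℝ} (hδ0 : 0 ≤ δ) (hδq : δ ≤ 1 / (16 * q))
    (hcmp : ∀ κ, |(fourierCoeff 𝒞a κ).re - (fourierCoeff 𝒞b κ).re| ≤ δ * (fourierCoeff 𝒞a κ).re)
    {X : Finset (Fin d → ZMod M)} (hX : IsPolymer (L ^ k) X)
    {F : ((Fin d → ZMod M) → ℝ) → ℂ} {b : ℝ} (hb : 0 ≤ b) (hFd : ContDiff ℝ r₀ F)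
    (hFloc : IsGaugeLocal ((abkmNormParams L N Mord R pT r₀ h θbar A (schedDelta δ₀ δ₁ N) 𝒞).gauge k X) F)
    (hF : TayNormLE ((abkmNormParams L N Mord R pT r₀ h θbar A (schedDelta δ₀ δ₁ N) 𝒞).gauge k X) r₀
      ((abkmWeightData L N Mord R θbar (schedDelta δ₀ δ₁ N) 𝒞).weight k X) F b) :
    TayNormLE ((abkmNormParams L N Mord R pT r₀ h θbar A (schedDelta δ₀ δ₁ N) 𝒞).gauge k X) r₀
      ((abkmWeightData L N Mord R θbar (schedDelta δ₀ δ₁ N) 𝒞).midWeight k X) (fluct 𝒞a F - fluct 𝒞b F)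
      (b * ((r₀ + 1) * gaussCompConst (Fintype.card (Fin d → ZMod M)) q * δ) *
        (A𝒫p ^ (1 / p)) ^ numBlocks (L ^ k) X) := by
  have h := tayNormLE_fluct_sub_fluct_abkm hB hSa hSb hpq hSp hea heb h0a h0b hposa hposb hδ0 hδq hcmp hX
    hb hFd hFloc hF (pT := pT) (h := h) (A := A)
  rw [pow_rpow_inv_eq_rpow_inv_pow hA𝒫p] at h
  convert h using 1
  ring

/-- **`‖B_{𝒞a} K − B_{𝒞b} K‖_{k+1,0} ≤ L^d · C_{8.7} · C ℓ κ A^{−1}` for the torus data from primitive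
hypotheses on the pair of kernels** (`ℓ = (r₀+1)·gaussCompConst(|Λ|,q)·δ`, `κ = A𝒫p^{1/p}`): hypothesis
(12.52) of Lemma 12.6 for `B_k` at the level of step kernels — the Lipschitz constant in `q` follows
with `δ = τ(1+τ)`, `K|q−q'| ≤ log(1+τ)` (`abs_re_fourierCoeff_sub_le_of_torusFRD`).
[cite: AdamsBuchholzKoteckyMuller2019, Lemma 12.6 (12.52)] -/
theorem hamNorm_opB_sub_abkm_le {L N Mord R n pT r₀ : ℕ}
    {θbar lam μ δ₁ δ₀ A𝒫 A𝒫a A𝒫b A𝒫p C₂a C₂b C₂p h A : ℝ}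
    {𝒞 : ℕ → (Fin d → ZMod M) → ℝ} (hd : 3 ≤ d) (hLodd : Odd L) (hL : 2 ^ (d + 3) + 16 * R ≤ L)
    (hM : M = L ^ N) {k : ℕ} (hkN : k + 1 ≤ N) (hpM : pT + d ≤ Mord) (hMR : Mord ≤ R)
    (hr₀ : 3 ≤ r₀)
    (hB : AbkmWeightBounds L N Mord R n θbar lam μ δ₁ δ₀ A𝒫 𝒞
      (abkmWeightData L N Mord R θbar (schedDelta δ₀ δ₁ N) 𝒞))
    (hh : 0 < h) (hA : 1 ≤ A)
    (Da Db : StepData d M)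
    (hSa : StepKernelBounds (abkmWeightData L N Mord R θbar (schedDelta δ₀ δ₁ N) 𝒞) L k A𝒫a C₂a Da.𝒞)
    (hSb : StepKernelBounds (abkmWeightData L N Mord R θbar (schedDelta δ₀ δ₁ N) 𝒞) L k A𝒫b C₂b Db.𝒞)
    {p q : ℝ} (hpq : p.HolderConjugate q)
    (hSp : StepKernelBounds (abkmWeightData L N Mord R θbar (schedDelta δ₀ δ₁ N) 𝒞) L k A𝒫p C₂p
      (fun x => p * Db.𝒞 x)) (hA𝒫p : 0 ≤ A𝒫p)
    (hea : ∀ x, Da.𝒞 (-x) = Da.𝒞 x) (heb : ∀ x, Db.𝒞 (-x) = Db.𝒞 x)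
    (h0a : ∑ x, Da.𝒞 x = 0) (h0b : ∑ x, Db.𝒞 x = 0)
    (hposa : ∀ κ, κ ≠ 0 → 0 < (fourierCoeff Da.𝒞 κ).re)
    (hposb : ∀ κ, κ ≠ 0 → 0 < (fourierCoeff Db.𝒞 κ).re)
    {δ : ℝ} (hδ0 : 0 ≤ δ) (hδq : δ ≤ 1 / (16 * q))
    (hcmp : ∀ κ, |(fourierCoeff Da.𝒞 κ).re - (fourierCoeff Db.𝒞 κ).re| ≤ δ * (fourierCoeff Da.𝒞 κ).re)
    {x₀ : Fin d → ZMod M} (hB₀ : Da.B₀ = blockOf (L ^ k) x₀)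
    (hc₀ : Da.c₀ = boxCorner (L ^ k) (starRad R L d k) x₀) (hB₀' : Db.B₀ = Da.B₀) (hc₀' : Db.c₀ = Da.c₀)
    {K : Finset (Fin d → ZMod M) → ((Fin d → ZMod M) → ℝ) → ℂ} {C : ℝ} (hC : 0 ≤ C)
    (hK : WeakNormLE (abkmNormParams L N Mord R pT r₀ h θbar A (schedDelta δ₀ δ₁ N) 𝒞) k K C)
    (hKd : ∀ X, ContDiff ℝ r₀ (K X))
    (hKloc : ∀ X, IsPolymer (L ^ k) X → IsConn X →
      IsGaugeLocal ((abkmNormParams L N Mord R pT r₀ h θbar A (schedDelta δ₀ δ₁ N) 𝒞).gauge k X) (K X)) :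
    hamNorm (fieldWt h L d (k + 1)) ((L : ℝ) ^ (k + 1)) (L ^ (d * (k + 1))) (opB Da K - opB Db K) ≤
      (L : ℝ) ^ d * (pi2BoundConst d (((2 * R + 2 : ℕ) : ℝ) + ((d / 2 + 1 : ℕ) : ℝ)) *
        (C * ((r₀ + 1) * gaussCompConst (Fintype.card (Fin d → ZMod M)) q * δ) * A𝒫p ^ (1 / p) * A⁻¹)) :=
  hamNorm_opB_sub_abkm_le_of_stepKernelBounds hd hLodd hL hM hkN hpM hMR hr₀ hB hh hA Da Db hSa hSb hB₀ hc₀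
    hB₀' hc₀' (ℓ := (r₀ + 1) * gaussCompConst (Fintype.card (Fin d → ZMod M)) q * δ) (κ := A𝒫p ^ (1 / p))
    (fun _ hX _ _ _ hb hFd hFloc hF =>
      tayNormLE_fluct_sub_fluct_pow_abkm hB hSa hSb hpq hSp hA𝒫p hea heb h0a h0b hposa hposb hδ0 hδq hcmp
        hX hb hFd hFloc hF)
    hC hK hKd hKloc

end Literature.MathematicalPhysics.StatisticalMechanics.GradientRG

end
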